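import Summits.HubbardSuperconductivity.HubbardSuperconductivity.Theorems.ColourTheSpinSgEndpointFlatLimitBounds
import Literature.MathematicalPhysics.QuantumLattice.FinDimSpectrumSectorGibbsLimit
import HarnessLib

/-!
# Crux `SgEndpoint` (stmt-HubbardSuperconductivity-16272, route `ColourTheSpin`), alt line
# `penalty_chord`, stub P3 `stub_penalisedEndpoint` — file 1/2: the `κ`-chord at fixed `g`

Energy-currency version of the `g → 0⁺` endpoint (strategist census `Cruxes/SgEndpoint/STRATEGY-
CENSUS.md` §F2–F4): with a DISFAVOURING pair source `κ' · Δ^g†Δ^g` (`κ' ≥ 0`) added to the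
`Q₈`-spin-gauged torus `H_g`, the penalised frozen energies
`eP(k) = min Rayleigh_N (H_F(k) + κ' P_k†P_k)` over FLAT link configurations obey, for every small
`g` at which a unit block ground state `χ` of `H_g + κ'Δ^g†Δ^g` has pair order `Re ⟨χ, Δ^g†Δ^g χ⟩ ≥ c`,

  `eP(k) + g² |Bond L|(1 - 1/8) ≥ min_{flat} e₀ + κ' c`   for every flat `k`   (`penalised_chord`)

(upper bound: trial state `φ ⊗ |k⟩` at a flat `k` with an `N`-sector ground state `φ` of the penalised
frozen block; lower bound: electric form `≥ 0`, magnetic form `≥` the off-flat weight, gauge–fermion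
form `≥ e₀` blockwise — file `…FlatLimitBounds`). Ingredients proved here: particle-number conservation
of `Δ^g†Δ^g` (`hasShift_card_spinGaugedPairField`), block ground states of the penalised Hamiltonian
and of its frozen blocks (`exists_groundState_cardBlock_penalised`,
`exists_unit_groundState_frozenPenalised`), the trial-state energy (`form_single_flat_penalised`).
Kogut–Susskind, PRD 11 (1975) 395 §§III–IV; Kaplan–Horsch–von der Linden, J. Phys. Soc. Jpn. 58 (1989)
3894 (disfavouring-source chord).
-/

noncomputable section

namespace Summit.HubbardSuperconductivity.ColourTheSpin.SgEndpoint

open Matrix Finset Literature.MathematicalPhysics.QuantumLattice SpinGauged GaugedHubbard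
open scoped ComplexOrder Kronecker

section Main

variable (L : ℕ) [NeZero L]

/-! ### Particle-number conservation of the pair order -/

/-- **The transported pair field removes two particles**: `Δ^g` carries charge `-2` for the
grading `(s, k) ↦ #s`. [folklore] -/
theorem hasShift_card_spinGaugedPairField :
    HasShift (fun ik : Index L Q8 => wt (fun _ : Orb (FermionTorus 2 L) => (1 : ℤ)) ik.1)
      (spinGaugedPairField L) (-2) := by
  have hgrade : (fun ik : Index L Q8 =>
      wt (fun _ : Orb (FermionTorus 2 L) => (1 : ℤ)) ik.1 + (fun _ : Bond L → Q8 => (0 : ℤ)) ik.2) =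
      fun ik => wt (fun _ : Orb (FermionTorus 2 L) => (1 : ℤ)) ik.1 := by
    funext ik
    simp
  unfold spinGaugedPairField spinGaugedPairFieldWith
  refine HasShift.sum _ fun b _ => HasShift.smul ?_ _
  refine HasShift.sum _ fun σ _ => HasShift.sum _ fun τ _ => ?_
  exact ((((hasShift_annihilation (fun _ : Orb (FermionTorus 2 L) => (1 : ℤ)) (orb b.1 σ)).mul
    (hasShift_annihilation (fun _ : Orb (FermionTorus 2 L) => (1 : ℤ)) (orb (b.1.shift b.2) τ))).kronecker
      (HasShift.diagonal (d := fun _ : Bond L → Q8 => (0 : ℤ)) _)).congr_grading hgrade).of_eq (by norm_num)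

/-- **The pair order `Δ^g†Δ^g` conserves the particle number.** [folklore] -/
theorem hasShift_card_pairOrder :
    HasShift (fun ik : Index L Q8 => wt (fun _ : Orb (FermionTorus 2 L) => (1 : ℤ)) ik.1)
      ((spinGaugedPairField L)ᴴ * spinGaugedPairField L) 0 :=
  (((hasShift_card_spinGaugedPairField L).conjTranspose).mul (hasShift_card_spinGaugedPairField L)).of_eq
    (by norm_num)

/-- Matrix entries of `Δ^g†Δ^g` between different particle numbers vanish. [folklore] -/
theorem pairOrder_apply_of_card_ne {s s' : Finset (Orb (FermionTorus 2 L))} (h : s.card ≠ s'.card)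
    (k k' : Bond L → Q8) :
    ((spinGaugedPairField L)ᴴ * spinGaugedPairField L) (s, k) (s', k') = 0 := by
  refine (hasShift_card_pairOrder L).apply_eq_zero ?_
  simpa [wt_one_eq_card] using h

/-- The pair order is Hermitian. [folklore] -/
theorem isHermitian_pairOrder : ((spinGaugedPairField L)ᴴ * spinGaugedPairField L).IsHermitian :=
  isHermitian_conjTranspose_mul_self _

variable (U : ℝ)

/-- **The penalised Hamiltonian `H_g + κ' Δ^g†Δ^g` is Hermitian.** [folklore] -/
theorem isHermitian_penalised (g κ' : ℝ) :
    (spinGaugedHubbardTorus L U g + ((κ' : ℝ) : ℂ) • ((spinGaugedPairField L)ᴴ * spinGaugedPairField L)).IsHermitian :=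
  (isHermitian_spinGaugedHubbardTorus L U g).add (isHermitian_real_smul κ' (isHermitian_pairOrder L))

/-- Entries of the penalised Hamiltonian between different particle numbers vanish. [folklore] -/
theorem penalised_apply_of_card_ne (g κ' : ℝ) {s s' : Finset (Orb (FermionTorus 2 L))} (h : s.card ≠ s'.card)
    (k k' : Bond L → Q8) :
    (spinGaugedHubbardTorus L U g + ((κ' : ℝ) : ℂ) • ((spinGaugedPairField L)ᴴ * spinGaugedPairField L)) (s, k) (s', k') = 0 := by
  rw [Matrix.add_apply, Matrix.smul_apply, pairOrder_apply_of_card_ne L h, smul_zero, add_zero]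
  exact spinGaugedHubbardTorusWith_apply_of_card_ne Q8.rep L U _ _ h k k'

/-! ### Block ground states of the penalised Hamiltonian -/

/-- **A normalised ground state of the `N`-block of the penalised Hamiltonian**, with its Rayleigh
bound on the block. [folklore] -/
theorem exists_groundState_cardBlock_penalised (g κ' : ℝ) {N : ℕ}
    (hN : ∃ s : Finset (Orb (FermionTorus 2 L)), s.card = N) :
    ∃ Ψ : Index L Q8 → ℂ, (∀ ik : Index L Q8, ik.1.card ≠ N → Ψ ik = 0) ∧ star Ψ ⬝ᵥ Ψ = 1 ∧
      ∃ E : ℝ, (spinGaugedHubbardTorus L U g + ((κ' : ℝ) : ℂ) • ((spinGaugedPairField L)ᴴ * spinGaugedPairField L)) *ᵥ Ψ =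
          (E : ℂ) • Ψ ∧
        ∀ Φ : Index L Q8 → ℂ, (∀ ik : Index L Q8, ik.1.card ≠ N → Φ ik = 0) →
          E * (star Φ ⬝ᵥ Φ).re ≤
            (star Φ ⬝ᵥ (spinGaugedHubbardTorus L U g +
              ((κ' : ℝ) : ℂ) • ((spinGaugedPairField L)ᴴ * spinGaugedPairField L)) *ᵥ Φ).re := by
  classical
  set H := spinGaugedHubbardTorus L U g + ((κ' : ℝ) : ℂ) • ((spinGaugedPairField L)ᴴ * spinGaugedPairField L)
    with hH
  let K : Submodule ℂ (Index L Q8 → ℂ) :=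
    { carrier := {v | ∀ ik : Index L Q8, ¬ ik.1.card = N → v ik = 0}
      add_mem' := fun {v w} hv hw ik hik => by simp [Pi.add_apply, hv ik hik, hw ik hik]
      zero_mem' := fun _ _ => rfl
      smul_mem' := fun c v hv ik hik => by simp [hv ik hik] }
  have hK : ∀ v, v ∈ K ↔ ∀ ik : Index L Q8, ¬ ik.1.card = N → v ik = 0 := fun v => Iff.rfl
  obtain ⟨s₀, hs₀⟩ := hN
  have hp : ∃ ik : Index L Q8, ik.1.card = N := ⟨(s₀, fun _ => 1), hs₀⟩
  have hinv : ∀ i j : Index L Q8, ¬ i.1.card = N → j.1.card = N → H i j = 0 := by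
    intro i j hi hj
    obtain ⟨s, k⟩ := i
    obtain ⟨s', k'⟩ := j
    exact penalised_apply_of_card_ne L U g κ' (by rw [hj]; exact hi) k k'
  have hHerm : H.IsHermitian := isHermitian_penalised L U g κ'
  obtain ⟨⟨v, hvK, hv0, hv⟩, hray⟩ :=
    sector_groundState H hHerm (fun ik : Index L Q8 => ik.1.card = N) hp hinv K hK
  obtain ⟨c, hc, hunit⟩ := exists_smul_unit hv0
  refine ⟨c • v, fun ik hik => by simp [(hK v).1 hvK ik hik], hunit, H.minEnergyOn K, ?_, ?_⟩
  · rw [mulVec_smul, hv, smul_comm]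
  · intro Φ hΦ
    exact rayleigh_of_unit (p := fun ik : Index L Q8 => ik.1.card = N)
      (fun w hw hw1 => hray w ((hK w).2 hw) hw1) Φ hΦ

/-! ### The penalised frozen blocks -/

/-- The `(·,k)(·,k)` block of `Δ^g†Δ^g` is `P_k† P_k`. [folklore] -/
theorem pairOrder_apply_same (k : Bond L → Q8) (s s' : Finset (Orb (FermionTorus 2 L))) :
    ((spinGaugedPairField L)ᴴ * spinGaugedPairField L) (s, k) (s', k) =
      (((spinGaugedPairField L).submatrix (fun s => (s, k)) (fun s => (s, k)))ᴴ *
        (spinGaugedPairField L).submatrix (fun s => (s, k)) (fun s => (s, k))) s s' := by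
  unfold spinGaugedPairField
  conv_lhs => rw [pairOrder_eq_linkDiag_submatrix Q8.rep L]
  rw [linkDiag_apply, if_pos rfl]

/-- Entries of the penalised frozen block `H_F(k) + κ' P_k†P_k` between different particle numbers
vanish. [folklore] -/
theorem frozenPenalised_apply_of_card_ne (κ' : ℝ) (k : Bond L → Q8) {s s' : Finset (Orb (FermionTorus 2 L))}
    (h : s.card ≠ s'.card) :
    ((spinGaugedHubbardTorusWith Q8.rep L U 0 0).submatrix (fun s => (s, k)) (fun s => (s, k)) +
      ((κ' : ℝ) : ℂ) • ((((spinGaugedPairField L).submatrix (fun s => (s, k)) (fun s => (s, k)))ᴴ *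
        (spinGaugedPairField L).submatrix (fun s => (s, k)) (fun s => (s, k))))) s s' = 0 := by
  rw [Matrix.add_apply, Matrix.smul_apply, submatrix_apply, ← pairOrder_apply_same,
    pairOrder_apply_of_card_ne L h, spinGaugedHubbardTorusWith_apply_of_card_ne Q8.rep L U 0 0 h,
    smul_zero, add_zero]

/-- The penalised frozen block is Hermitian. [folklore] -/
theorem isHermitian_frozenPenalised (κ' : ℝ) (k : Bond L → Q8) :
    ((spinGaugedHubbardTorusWith Q8.rep L U 0 0).submatrix (fun s => (s, k)) (fun s => (s, k)) +
      ((κ' : ℝ) : ℂ) • ((((spinGaugedPairField L).submatrix (fun s => (s, k)) (fun s => (s, k)))ᴴ *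
        (spinGaugedPairField L).submatrix (fun s => (s, k)) (fun s => (s, k))))).IsHermitian :=
  ((isHermitian_spinGaugedHubbardTorusWith Q8.rep L Q8.star_trace_rep U 0 0).submatrix _).add
    (isHermitian_real_smul κ' (isHermitian_conjTranspose_mul_self _))

/-- **A normalised `N`-sector ground state of the penalised frozen block** `H_F(k) + κ' P_k†P_k`.
[folklore] -/
theorem exists_unit_groundState_frozenPenalised (κ' : ℝ) (k : Bond L → Q8) {N : ℕ}
    (hN : ∃ s : Finset (Orb (FermionTorus 2 L)), s.card = N) :
    ∃ φ : Fock (Orb (FermionTorus 2 L)),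
      φ ∈ (nParticleSubmodule N : Submodule ℂ (Fock (Orb (FermionTorus 2 L)))) ∧ star φ ⬝ᵥ φ = 1 ∧
      ((spinGaugedHubbardTorusWith Q8.rep L U 0 0).submatrix (fun s => (s, k)) (fun s => (s, k)) +
        ((κ' : ℝ) : ℂ) • ((((spinGaugedPairField L).submatrix (fun s => (s, k)) (fun s => (s, k)))ᴴ *
          (spinGaugedPairField L).submatrix (fun s => (s, k)) (fun s => (s, k))))) *ᵥ φ =
        ((((spinGaugedHubbardTorusWith Q8.rep L U 0 0).submatrix (fun s => (s, k)) (fun s => (s, k)) +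
          ((κ' : ℝ) : ℂ) • ((((spinGaugedPairField L).submatrix (fun s => (s, k)) (fun s => (s, k)))ᴴ *
            (spinGaugedPairField L).submatrix (fun s => (s, k)) (fun s => (s, k))))).minEnergyOn
              (nParticleSubmodule N : Submodule ℂ (Fock (Orb (FermionTorus 2 L)))) : ℝ) : ℂ) • φ := by
  classical
  set HF := (spinGaugedHubbardTorusWith Q8.rep L U 0 0).submatrix (fun s => (s, k)) (fun s => (s, k)) +
    ((κ' : ℝ) : ℂ) • ((((spinGaugedPairField L).submatrix (fun s => (s, k)) (fun s => (s, k)))ᴴ *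
      (spinGaugedPairField L).submatrix (fun s => (s, k)) (fun s => (s, k)))) with hHF
  have hHerm : HF.IsHermitian := isHermitian_frozenPenalised L U κ' k
  have hinv : ∀ s s' : Finset (Orb (FermionTorus 2 L)), ¬ s.card = N → s'.card = N → HF s s' = 0 := by
    intro s s' hs hs'
    exact frozenPenalised_apply_of_card_ne L U κ' k (by rw [hs']; exact hs)
  have hK : ∀ v : Fock (Orb (FermionTorus 2 L)),
      v ∈ (nParticleSubmodule N : Submodule ℂ (Fock (Orb (FermionTorus 2 L)))) ↔
        ∀ s, ¬ s.card = N → v s = 0 := fun v => Iff.rfl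
  obtain ⟨⟨v, hvK, hv0, hv⟩, -⟩ :=
    sector_groundState HF hHerm (fun s : Finset (Orb (FermionTorus 2 L)) => s.card = N) hN hinv _ hK
  obtain ⟨c, hc, hunit⟩ := exists_smul_unit hv0
  refine ⟨c • v, Submodule.smul_mem _ _ hvK, hunit, ?_⟩
  rw [mulVec_smul, hv, smul_comm]

/-- **Rayleigh lower bound of a penalised frozen block on the `N`-sector**:
`eP(k) ‖φ‖² ≤ Re ⟨φ, (H_F(k) + κ'P_k†P_k) φ⟩`. [folklore] -/
theorem frozenPenalised_minEnergyOn_le_rayleigh (κ' : ℝ) (k : Bond L → Q8) {N : ℕ}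
    (φ : Fock (Orb (FermionTorus 2 L)))
    (hφ : φ ∈ (nParticleSubmodule N : Submodule ℂ (Fock (Orb (FermionTorus 2 L))))) :
    ((spinGaugedHubbardTorusWith Q8.rep L U 0 0).submatrix (fun s => (s, k)) (fun s => (s, k)) +
        ((κ' : ℝ) : ℂ) • ((((spinGaugedPairField L).submatrix (fun s => (s, k)) (fun s => (s, k)))ᴴ *
          (spinGaugedPairField L).submatrix (fun s => (s, k)) (fun s => (s, k))))).minEnergyOn
          (nParticleSubmodule N : Submodule ℂ (Fock (Orb (FermionTorus 2 L)))) * (star φ ⬝ᵥ φ).re ≤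
      (star φ ⬝ᵥ ((spinGaugedHubbardTorusWith Q8.rep L U 0 0).submatrix (fun s => (s, k)) (fun s => (s, k)) +
        ((κ' : ℝ) : ℂ) • ((((spinGaugedPairField L).submatrix (fun s => (s, k)) (fun s => (s, k)))ᴴ *
          (spinGaugedPairField L).submatrix (fun s => (s, k)) (fun s => (s, k))))) *ᵥ φ).re := by
  have hK : ∀ v : Fock (Orb (FermionTorus 2 L)),
      v ∈ (nParticleSubmodule N : Submodule ℂ (Fock (Orb (FermionTorus 2 L)))) ↔
        ∀ s, ¬ s.card = N → v s = 0 := fun v => Iff.rfl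
  exact rayleigh_of_unit (p := fun s : Finset (Orb (FermionTorus 2 L)) => s.card = N)
    (fun w hw hw1 => minEnergyOn_le_rayleigh_of_mem (isHermitian_frozenPenalised L U κ' k) _ ((hK w).2 hw) hw1)
    φ ((hK φ).1 hφ)

/-! ### The trial state for the penalised Hamiltonian -/

/-- **Energy of `φ₀ ⊗ |k₀⟩` at a flat `k₀` for the penalised Hamiltonian**:
`⟨φ₀ ⊗ k₀, (H_g + κ'Δ^g†Δ^g)(φ₀ ⊗ k₀)⟩ = ⟨φ₀, (H_F(k₀) + κ'P_{k₀}†P_{k₀}) φ₀⟩ + g²|Bond L|(1 - 1/8) ‖φ₀‖²`.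
[folklore] -/
theorem form_single_flat_penalised (g κ' : ℝ) (k₀ : Bond L → Q8) (hflat : ∀ x, holonomy L k₀ x = 1)
    (φ₀ : Fock (Orb (FermionTorus 2 L))) :
    star (fun ik : Index L Q8 => if ik.2 = k₀ then φ₀ ik.1 else 0) ⬝ᵥ
        (spinGaugedHubbardTorus L U g + ((κ' : ℝ) : ℂ) • ((spinGaugedPairField L)ᴴ * spinGaugedPairField L)) *ᵥ
          (fun ik : Index L Q8 => if ik.2 = k₀ then φ₀ ik.1 else 0) =
      star φ₀ ⬝ᵥ ((spinGaugedHubbardTorusWith Q8.rep L U 0 0).submatrix (fun s => (s, k₀)) (fun s => (s, k₀)) +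
        ((κ' : ℝ) : ℂ) • ((((spinGaugedPairField L).submatrix (fun s => (s, k₀)) (fun s => (s, k₀)))ᴴ *
          (spinGaugedPairField L).submatrix (fun s => (s, k₀)) (fun s => (s, k₀))))) *ᵥ φ₀ +
      ((g ^ 2 * ((Fintype.card (Bond L) : ℝ) * (1 - 1 / 8)) : ℝ) : ℂ) * (star φ₀ ⬝ᵥ φ₀) := by
  set Φ₀ : Index L Q8 → ℂ := fun ik => if ik.2 = k₀ then φ₀ ik.1 else 0 with hΦ₀
  have hA : star Φ₀ ⬝ᵥ spinGaugedHubbardTorusWith Q8.rep L U 0 0 *ᵥ Φ₀ =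
      star φ₀ ⬝ᵥ (spinGaugedHubbardTorusWith Q8.rep L U 0 0).submatrix (fun s => (s, k₀)) (fun s => (s, k₀)) *ᵥ φ₀ := by
    conv_lhs => rw [spinGaugedHubbardTorusWith_zero_zero_eq_linkDiag_submatrix Q8.rep L U]
    rw [hΦ₀, star_dotProduct_single_linkDiag_mulVec]
  have hP : star Φ₀ ⬝ᵥ ((spinGaugedPairField L)ᴴ * spinGaugedPairField L) *ᵥ Φ₀ =
      star φ₀ ⬝ᵥ ((((spinGaugedPairField L).submatrix (fun s => (s, k₀)) (fun s => (s, k₀)))ᴴ *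
        (spinGaugedPairField L).submatrix (fun s => (s, k₀)) (fun s => (s, k₀)))) *ᵥ φ₀ := by
    unfold spinGaugedPairField
    conv_lhs => rw [pairOrder_eq_linkDiag_submatrix Q8.rep L]
    rw [hΦ₀, star_dotProduct_single_linkDiag_mulVec]
  have hE : star Φ₀ ⬝ᵥ ((1 : Matrix (Finset (Orb (FermionTorus 2 L))) (Finset (Orb (FermionTorus 2 L))) ℂ) ⊗ₖ
      (electric L : Matrix (Bond L → Q8) _ ℂ)) *ᵥ Φ₀ =
      ((Fintype.card (Bond L) : ℂ) * (1 - 1 / 8)) * (star φ₀ ⬝ᵥ φ₀) := by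
    rw [hΦ₀, star_dotProduct_one_kronecker_mulVec_single, electric_apply_self, Q8.card]
    norm_num
  have hM : star Φ₀ ⬝ᵥ ((1 : Matrix (Finset (Orb (FermionTorus 2 L))) (Finset (Orb (FermionTorus 2 L))) ℂ) ⊗ₖ
      SpinGauged.magnetic Q8.rep L) *ᵥ Φ₀ = 0 := by
    rw [hΦ₀, star_dotProduct_one_kronecker_mulVec_single]
    unfold SpinGauged.magnetic
    rw [diagonal_apply_eq, q8_magnetic_diag_eq_zero_of_flat L k₀ hflat, zero_mul]
  rw [add_mulVec, dotProduct_add, smul_mulVec, dotProduct_smul, hP, add_mulVec, dotProduct_add,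
    smul_mulVec, dotProduct_smul]
  unfold spinGaugedHubbardTorus
  rw [spinGaugedHubbardTorusWith_eq_add Q8.rep L U (g ^ 2) (1 / g ^ 2), add_mulVec, add_mulVec,
    dotProduct_add, dotProduct_add, smul_mulVec, smul_mulVec, dotProduct_smul,
    dotProduct_smul, hA, hE, hM, smul_zero, add_zero]
  simp only [smul_eq_mul]
  push_cast
  ring

/-- **Variational upper bound for the penalised block energy at a flat configuration**:
`E ≤ eP(k₀) + g²|Bond L|(1 - 1/8)`. [folklore] -/
theorem penalisedBlockEnergy_le {N : ℕ} (hN : ∃ s : Finset (Orb (FermionTorus 2 L)), s.card = N)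
    (g κ' : ℝ) (k₀ : Bond L → Q8) (hflat : ∀ x, holonomy L k₀ x = 1) {E : ℝ}
    (hray : ∀ Φ : Index L Q8 → ℂ, (∀ ik : Index L Q8, ik.1.card ≠ N → Φ ik = 0) →
      E * (star Φ ⬝ᵥ Φ).re ≤
        (star Φ ⬝ᵥ (spinGaugedHubbardTorus L U g +
          ((κ' : ℝ) : ℂ) • ((spinGaugedPairField L)ᴴ * spinGaugedPairField L)) *ᵥ Φ).re) :
    E ≤ ((spinGaugedHubbardTorusWith Q8.rep L U 0 0).submatrix (fun s => (s, k₀)) (fun s => (s, k₀)) +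
        ((κ' : ℝ) : ℂ) • ((((spinGaugedPairField L).submatrix (fun s => (s, k₀)) (fun s => (s, k₀)))ᴴ *
          (spinGaugedPairField L).submatrix (fun s => (s, k₀)) (fun s => (s, k₀))))).minEnergyOn
          (nParticleSubmodule N : Submodule ℂ (Fock (Orb (FermionTorus 2 L)))) +
      g ^ 2 * ((Fintype.card (Bond L) : ℝ) * (1 - 1 / 8)) := by
  obtain ⟨φ₀, hφ₀N, hφ₀1, heig⟩ := exists_unit_groundState_frozenPenalised L U κ' k₀ hN
  have h := hray _ (single_supported L k₀ hφ₀N)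
  rw [form_single_flat_penalised L U g κ' k₀ hflat, heig, dotProduct_smul, star_dotProduct_single_self, hφ₀1,
    smul_eq_mul, mul_one, mul_one, Complex.one_re, mul_one, Complex.add_re, Complex.ofReal_re,
    Complex.ofReal_re] at h
  exact h

/-! ### The chord at fixed `g` -/

/-- **The `κ`-chord at fixed `g`.** Let `k₀` minimise the frozen energy `e₀` among flat
configurations (`e = e₀(k₀)`, `E_A = E₀(A)`), `0 < g` with `e - E_A ≤ g⁻²`, `0 ≤ κ'`, and let `χ` be a
unit block ground state of `H_g + κ'Δ^g†Δ^g` (eigenvalue `E`, Rayleigh bound on the `N`-block) with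
pair order `c ≤ Re ⟨χ, Δ^g†Δ^g χ⟩`. Then for every flat `k`:
`e + κ' c ≤ eP(k) + g²|Bond L|(1 - 1/8)`. [folklore] -/
theorem penalised_chord {N : ℕ} (hN : ∃ s : Finset (Orb (FermionTorus 2 L)), s.card = N)
    {g : ℝ} (hg : 0 < g) (k₀ : Bond L → Q8)
    (hmin : ∀ k : Bond L → Q8, (∀ x, holonomy L k x = 1) →
      ((spinGaugedHubbardTorusWith Q8.rep L U 0 0).submatrix (fun s => (s, k₀)) (fun s => (s, k₀))).minEnergyOn
          (nParticleSubmodule N : Submodule ℂ (Fock (Orb (FermionTorus 2 L)))) ≤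
        ((spinGaugedHubbardTorusWith Q8.rep L U 0 0).submatrix (fun s => (s, k)) (fun s => (s, k))).minEnergyOn
          (nParticleSubmodule N : Submodule ℂ (Fock (Orb (FermionTorus 2 L)))))
    (hgsmall : ((spinGaugedHubbardTorusWith Q8.rep L U 0 0).submatrix (fun s => (s, k₀)) (fun s => (s, k₀))).minEnergyOn
          (nParticleSubmodule N : Submodule ℂ (Fock (Orb (FermionTorus 2 L)))) -
        (spinGaugedHubbardTorusWith Q8.rep L U 0 0).groundEnergy ≤ 1 / g ^ 2)
    {κ' : ℝ} (hκ : 0 ≤ κ')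
    {χ : Index L Q8 → ℂ} (hsupp : ∀ ik : Index L Q8, ik.1.card ≠ N → χ ik = 0) (hχ1 : star χ ⬝ᵥ χ = 1)
    {E : ℝ} (heig : (spinGaugedHubbardTorus L U g +
      ((κ' : ℝ) : ℂ) • ((spinGaugedPairField L)ᴴ * spinGaugedPairField L)) *ᵥ χ = (E : ℂ) • χ)
    (hray : ∀ Φ : Index L Q8 → ℂ, (∀ ik : Index L Q8, ik.1.card ≠ N → Φ ik = 0) →
      E * (star Φ ⬝ᵥ Φ).re ≤
        (star Φ ⬝ᵥ (spinGaugedHubbardTorus L U g +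
          ((κ' : ℝ) : ℂ) • ((spinGaugedPairField L)ᴴ * spinGaugedPairField L)) *ᵥ Φ).re)
    {c : ℝ} (hc : c ≤ (star χ ⬝ᵥ ((spinGaugedPairField L)ᴴ * spinGaugedPairField L) *ᵥ χ).re)
    (k : Bond L → Q8) (hk : ∀ x, holonomy L k x = 1) :
    ((spinGaugedHubbardTorusWith Q8.rep L U 0 0).submatrix (fun s => (s, k₀)) (fun s => (s, k₀))).minEnergyOn
          (nParticleSubmodule N : Submodule ℂ (Fock (Orb (FermionTorus 2 L)))) + κ' * c ≤
      ((spinGaugedHubbardTorusWith Q8.rep L U 0 0).submatrix (fun s => (s, k)) (fun s => (s, k)) +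
          ((κ' : ℝ) : ℂ) • ((((spinGaugedPairField L).submatrix (fun s => (s, k)) (fun s => (s, k)))ᴴ *
            (spinGaugedPairField L).submatrix (fun s => (s, k)) (fun s => (s, k))))).minEnergyOn
            (nParticleSubmodule N : Submodule ℂ (Fock (Orb (FermionTorus 2 L)))) +
        g ^ 2 * ((Fintype.card (Bond L) : ℝ) * (1 - 1 / 8)) := by
  -- names
  set A := spinGaugedHubbardTorusWith Q8.rep L U 0 0 with hA
  set R := (spinGaugedPairField L)ᴴ * spinGaugedPairField L with hR
  set e := (A.submatrix (fun s => (s, k₀)) (fun s => (s, k₀))).minEnergyOn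
    (nParticleSubmodule N : Submodule ℂ (Fock (Orb (FermionTorus 2 L)))) with he
  set EA := A.groundEnergy with hEA
  set wF := ∑ k ∈ Finset.univ.filter (fun k : Bond L → Q8 => ∀ x, holonomy L k x = 1),
    (star (fun s => χ (s, k)) ⬝ᵥ fun s => χ (s, k)).re with hwF
  set w := ∑ k ∈ Finset.univ.filter (fun k : Bond L → Q8 => ¬ ∀ x, holonomy L k x = 1),
    (star (fun s => χ (s, k)) ⬝ᵥ fun s => χ (s, k)).re with hw
  -- upper bound: trial state at `k`
  have hup := penalisedBlockEnergy_le L U hN g κ' k hk hray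
  -- `E = Re ⟨χ, H_g χ⟩ + κ' Re ⟨χ, R χ⟩`
  have hEform : E = (star χ ⬝ᵥ spinGaugedHubbardTorus L U g *ᵥ χ).re + κ' * (star χ ⬝ᵥ R *ᵥ χ).re := by
    have h := EigenvalueContinuation.re_star_dotProduct_mulVec_of_eigen heig
    rw [hχ1, Complex.one_re, mul_one, add_mulVec, dotProduct_add, smul_mulVec, dotProduct_smul,
      smul_eq_mul, Complex.add_re, Complex.re_ofReal_mul] at h
    exact h.symm
  -- the three pieces of `Re ⟨χ, H_g χ⟩`
  have hsplit : (star χ ⬝ᵥ spinGaugedHubbardTorus L U g *ᵥ χ).re =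
      (star χ ⬝ᵥ A *ᵥ χ).re +
        g ^ 2 * (star χ ⬝ᵥ ((1 : Matrix (Finset (Orb (FermionTorus 2 L))) (Finset (Orb (FermionTorus 2 L))) ℂ) ⊗ₖ
          (electric L : Matrix (Bond L → Q8) _ ℂ)) *ᵥ χ).re +
        (1 / g ^ 2) * (star χ ⬝ᵥ ((1 : Matrix (Finset (Orb (FermionTorus 2 L))) (Finset (Orb (FermionTorus 2 L))) ℂ) ⊗ₖ
          SpinGauged.magnetic Q8.rep L) *ᵥ χ).re := by
    unfold spinGaugedHubbardTorus
    rw [spinGaugedHubbardTorusWith_eq_add Q8.rep L U (g ^ 2) (1 / g ^ 2), add_mulVec, add_mulVec,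
      dotProduct_add, dotProduct_add, smul_mulVec, smul_mulVec, dotProduct_smul,
      dotProduct_smul, smul_eq_mul, smul_eq_mul, Complex.add_re, Complex.add_re, Complex.re_ofReal_mul,
      Complex.re_ofReal_mul]
  have hEl := re_electric_form_nonneg (G := Q8) L χ
  have hMag := q8_sum_nonflat_norm_sq_le_magnetic_form L χ
  have hlow : e * wF + EA * w ≤ (star χ ⬝ᵥ A *ᵥ χ).re :=
    gaugeFermion_form_ge L U hN hsupp (fun k hk => hmin k hk)
  have hsum : wF + w = 1 := by
    rw [hwF, hw, sum_flat_add_sum_nonflat, hχ1, Complex.one_re]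
  have hg2 : 0 < g ^ 2 := by positivity
  have hw0 : 0 ≤ w := Finset.sum_nonneg fun k _ => EigenvalueContinuation.re_star_dotProduct_self_nonneg _
  -- `Re ⟨χ, H_g χ⟩ ≥ e`
  have hHg : e ≤ (star χ ⬝ᵥ spinGaugedHubbardTorus L U g *ᵥ χ).re := by
    rw [hsplit]
    have h1 : 0 ≤ g ^ 2 * (star χ ⬝ᵥ ((1 : Matrix (Finset (Orb (FermionTorus 2 L))) (Finset (Orb (FermionTorus 2 L))) ℂ) ⊗ₖ
        (electric L : Matrix (Bond L → Q8) _ ℂ)) *ᵥ χ).re := mul_nonneg hg2.le hEl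
    have h2 : (1 / g ^ 2) * w ≤ (1 / g ^ 2) * (star χ ⬝ᵥ ((1 : Matrix (Finset (Orb (FermionTorus 2 L))) (Finset (Orb (FermionTorus 2 L))) ℂ) ⊗ₖ
        SpinGauged.magnetic Q8.rep L) *ᵥ χ).re := mul_le_mul_of_nonneg_left hMag (by positivity)
    -- `e wF + EA w + g⁻² w = e + w (g⁻² + EA - e) ≥ e`
    have h3 : 0 ≤ w * (1 / g ^ 2 + EA - e) := mul_nonneg hw0 (by linarith)
    have h4 : e * wF = e - e * w := by rw [show wF = 1 - w by linarith]; ring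
    nlinarith
  -- `κ' Re ⟨χ, R χ⟩ ≥ κ' c`
  have hRc : κ' * c ≤ κ' * (star χ ⬝ᵥ R *ᵥ χ).re := mul_le_mul_of_nonneg_left hc hκ
  linarith

end Main

section Registered

/-- **Registered helper `helper_penalisedChord` of stub P3** (one-line restatement of
`penalised_chord` with the section variables explicit). [folklore] -/
theorem helper_penalisedChord : ∀ (L : ℕ) [NeZero L] (U : ℝ) {N : ℕ} (hN : ∃ s : Finset (Orb (FermionTorus 2 L)), s.card = N) {g : ℝ} (hg : 0 < g) (k₀ : Bond L → Q8) (hmin : ∀ k : Bond L → Q8, (∀ x, holonomy L k x = 1) → ((spinGaugedHubbardTorusWith Q8.rep L U 0 0).submatrix (fun s => (s, k₀)) (fun s => (s, k₀))).minEnergyOn (nParticleSubmodule N : Submodule ℂ (Fock (Orb (FermionTorus 2 L)))) ≤ ((spinGaugedHubbardTorusWith Q8.rep L U 0 0).submatrix (fun s => (s, k)) (fun s => (s, k))).minEnergyOn (nParticleSubmodule N : Submodule ℂ (Fock (Orb (FermionTorus 2 L))))) (hgsmall : ((spinGaugedHubbardTorusWith Q8.rep L U 0 0).submatrix (fun s =>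 (s, k₀)) (fun s => (s, k₀))).minEnergyOn (nParticleSubmodule N : Submodule ℂ (Fock (Orb (FermionTorus 2 L)))) - (spinGaugedHubbardTorusWith Q8.rep L U 0 0).groundEnergy ≤ 1 / g ^ 2) {κ' : ℝ} (hκ : 0 ≤ κ') {χ : Index L Q8 → ℂ} (hsupp : ∀ ik : Index L Q8, ik.1.card ≠ N → χ ik = 0) (hχ1 : star χ ⬝ᵥ χ = 1) {E : ℝ} (heig : (spinGaugedHubbardTorus L U g + ((κ' : ℝ) : ℂ) • ((spinGaugedPairField L)ᴴ * spinGaugedPairField L)) *ᵥ χ = (E : ℂ) • χ) (hray : ∀ Φ : Index L Q8 → ℂ, (∀ ik : Index L Q8, ik.1.card ≠ N → Φ ik = 0) → E * (star Φ ⬝ᵥ Φ).re ≤ (star Φ ⬝ᵥ (spinGaugedHubbardTorus L U g + ((κ' : ℝ) : ℂ) • ((spinGaugedPairField L)ᴴ * spinGaugedPairField L)) *ᵥ Φ).re) {c : ℝ} (hc : c ≤ (star χ ⬝ᵥ ((spinGaugedPairField L)ᴴ * spinGaugedPairField L) *ᵥ χ).re) (k : Bond L → Q8) (hk : ∀ x,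 holonomy L k x = 1), ((spinGaugedHubbardTorusWith Q8.rep L U 0 0).submatrix (fun s => (s, k₀)) (fun s => (s, k₀))).minEnergyOn (nParticleSubmodule N : Submodule ℂ (Fock (Orb (FermionTorus 2 L)))) + κ' * c ≤ ((spinGaugedHubbardTorusWith Q8.rep L U 0 0).submatrix (fun s => (s, k)) (fun s => (s, k)) + ((κ' : ℝ) : ℂ) • ((((spinGaugedPairField L).submatrix (fun s => (s, k)) (fun s => (s, k)))ᴴ * (spinGaugedPairField L).submatrix (fun s => (s, k)) (fun s => (s, k))))).minEnergyOn (nParticleSubmodule N : Submodule ℂ (Fock (Orb (FermionTorus 2 L)))) + g ^ 2 * ((Fintype.card (Bond L) : ℝ) * (1 - 1 / 8)) :=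
  penalised_chord

end Registered

end Summit.HubbardSuperconductivity.ColourTheSpin.SgEndpoint

end
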